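/-
Copyright (c) 2026 the pub-hodgecm-mathlib formalisation cell (harness21).  Prover seat hodgecm-mathlib-K2E5-p16 (g7), Track B «K2-LIT»,
#184♮ = hLiu418 = `stmt-HodgeConjecture-24832`; S2-asm road (γ), (G3-b) `hbase` — INSTANCE CHARACTER, frame letter hypothesis-first (LEAD F0P6-plan (g14)
BATCH #32 (1); K2Liu-ref1 (g5) 14:36:51Z pin «at the compact-picture point `k = kV (1, v)`: `cp(archSW(Gauss))(v) = C · ∏_σ det(v_σ)^{ℓ_σ}`,
`ℓ_σ = M₂(t_σ+1)∕2 − p′_σ`»): the arch values of the frame Gaussian at reading points whose sign-frame components are `kV (α, β)` with `det α = 1`,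
`det β = d` (or `det α = d`, `det β = 1`) are `archSWValue … 1 · ∏_σ d_σ^{ℓ_σ}` with the explicit integer exponents.  THEOREMS ONLY (no `def`, no `instance`,
no notation, no `sorry`).
-/
import Summits.HodgeConjecture.HodgeConjecture.Theorems.K2LiuArchTensorKTypeCharacter   -- ★ PART 2b `archSWValue_archFrameGauss_mul_right_of_kV_cm`
import HarnessLib

/-!
# Crux `HLiu418`, S2-asm (γ) (G3-b), instance character: `archSWValue sB Y Φ_Gauss (pt x) = archSWValue sB Y Φ_Gauss 1 · ∏_σ d_σ(x)^{ℓ_σ}` at compact-type reading points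

Cell `hodgecm-mathlib`, crux item hLiu418 = `stmt-HodgeConjecture-24832` (helper lane `--supports`, count-neutral).

★ PART 2b `K2LiuArchTensorKTypeCharacter.archSWValue_archFrameGauss_mul_right_of_kV_cm` gives, for an arch `k` of the SMALL group with sign-frame components
`archUFormPi_𝔻 k σ = kV (a_σ, b_σ)`, the scalar `(∏_σ ((det a_σ det b_σ)^{M₂})^{e_σ}) · (∏_σ det a_σ^{q′_σ} det b_σ^{p′_σ})⁻¹`, `e_σ = (t_{w(σ)}+1)∕2` (integer division, as in
★ `etaD`), `(p′_σ, q′_σ)` the signature of `V′` at `σ`.  FILE 3's reading points (K2Liu-p05 lineage, ★ (G1-b)) are compact-type elements `pt x` whose components are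
`kV (α_σ(x), β_σ(x))` with ONE block scalar-trivial — the frame letter, carried HYPOTHESIS-FIRST here (`hfr`, `hα`, `hβ`; instance = the frame block of
`K2LiuArchSWSpanningSplit`).  Then:
* §1 `prod_pow_zpow_mul_inv_prod_pow` — the exponent bookkeeping `(∏ (d^{M₂})^{e}) · (∏ d^{p})⁻¹ = ∏ d^{M₂ e − p}` (`d ≠ 0`);
* §2 **`archSWValue_archFrameGauss_reading_of_det_snd`** — `det α_σ(x) = 1`, `det β_σ(x) = d_σ(x) ≠ 0` ⇒
  `archSWValue sB Y Φ_Gauss (pt x) = archSWValue sB Y Φ_Gauss 1 · ∏_σ d_σ(x)^{M₂ e_σ − p′_σ}` (ref1's `ℓ_σ`);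
  **`archSWValue_archFrameGauss_reading_of_det_fst`** — the mirror `det α_σ(x) = d_σ(x)`, `det β_σ(x) = 1` ⇒ exponent `M₂ e_σ − q′_σ`.
With ★ `K2LiuMultiPlaceAnchorBase.prod_realPlaces_eq_prod_complexPlaces` (σ ↦ w(σ)) and ★ `prod_slotHom_fkl_zero_mem_of_reading′` this is `hbase` at the instance
`d_σ(x) = det (v_x (w(σ)))`, `C = archSWValue sB Y Φ_Gauss 1 ≠ 0` (★ J1∕J2d vacuum value).
References: [KonnoKonno2007, Lemma 5.2 p. 73]; [LeeZhu1998, §5 (5.3)]; [Folland1989, §4.2 Prop. (4.39)]; [Paul1998, §1.2 (1.2.1)–(1.2.2)].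
HONEST LABEL: HC_CM is proved only modulo the 7 printed citations (2 remaining named inputs: hLiu418 = stmt-HodgeConjecture-24832,
h413 = stmt-HodgeConjecture-24833) until rung 0 closes; count-neutral helper, closes no socket.
-/

set_option autoImplicit false
set_option linter.dupNamespace false

noncomputable section

open scoped Matrix Classical
open NumberField NumberField.InfinitePlace NumberField.mixedEmbedding IsDedekindDomain

namespace Summit.HodgeConjecture.HodgeConjecture.Cruxes.HLiu418.K2LiuArchSWAnchorCharacter

/-! ## §1 Exponent bookkeeping -/

section Algebra

variable {ι : Type*} [Fintype ι]

/-- **`(∏_i (d_i^{M})^{e_i}) · (∏_i d_i^{p_i})⁻¹ = ∏_i d_i^{M e_i − p_i}`** for nonvanishing `d` (`zpow_mul`, `zpow_add₀`). [folklore] -/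
theorem prod_pow_zpow_mul_inv_prod_pow (d : ι → ℂ) (hd : ∀ i, d i ≠ 0) (M : ℕ) (e : ι → ℤ) (p : ι → ℕ) :
    (∏ i, (d i ^ M) ^ e i) * (∏ i, d i ^ p i)⁻¹ = ∏ i, d i ^ ((M : ℤ) * e i - (p i : ℤ)) := by
  rw [← Finset.prod_inv_distrib, ← Finset.prod_mul_distrib]
  refine Finset.prod_congr rfl fun i _ => ?_
  rw [← zpow_natCast (d i) M, ← zpow_mul, ← zpow_natCast (d i) (p i), ← zpow_neg, ← zpow_add₀ (hd i), sub_eq_add_neg]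

end Algebra

/-! ## §2 The character at compact-type reading points -/

section Reading

open Literature.NumberTheory.Automorphic Literature.NumberTheory.Automorphic.UnitaryGroup Literature.NumberTheory.Weil1964
open Literature.RepresentationTheory.KonnoKonno2007 Literature.RepresentationTheory.KonnoKonno2007.RealDualPair
open Literature.RepresentationTheory.HeisenbergGroup Literature.Analysis.SegalBargmann
open Literature.NumberTheory.GelbartRogawski1991 Literature.NumberTheory.GelbartRogawski1991.UnitaryDualPair
open Literature.NumberTheory.GelbartRogawski1991.UnitaryDualPair.LocalSplitting
open Literature.NumberTheory.GelbartRogawski1991.GRConstruction Literature.NumberTheory.K2Lit.SiegelDoubled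
open Literature.NumberTheory.GaloisRepresentations Literature.RepresentationTheory.HarrisKudlaSweet1996
open Summit.HodgeConjecture.HodgeConjecture.Cruxes.HLiu418 Summit.HodgeConjecture.HodgeConjecture.Cruxes.HLiu418.K2LiuArchSectionPlaceBlock
open Summit.HodgeConjecture.HodgeConjecture.Cruxes.HLiu418.K2LiuArchSWImageDefs
open Summit.HodgeConjecture.HodgeConjecture.Cruxes.HLiu418.K2LiuArchFrameGaussKType
open Summit.HodgeConjecture.HodgeConjecture.Cruxes.HLiu418.K2LiuArchTensorKTypeCharacter

variable (L : Type) [Field L] [NumberField L] [IsCMField L]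
variable {N M n : ℕ} (e : Fin N × Fin M ≃ Fin n)
  (dV : Fin N → L) (hdV : ∀ i, IsCMField.complexConj L (dV i) = dV i) (hdV0 : ∀ i, dV i ≠ 0)
  (dW : Fin M → L) (hdW : ∀ i, IsCMField.complexConj L (dW i) = dW i) (hdW0 : ∀ i, dW i ≠ 0)
variable {M₂ M' n' : ℕ} (eW : Fin M × Fin M₂ ≃ Fin M') (e' : Fin N × Fin M' ≃ Fin n')
  (dV' : Fin M₂ → L) (hdV' : ∀ k, IsCMField.complexConj L (dV' k) = dV' k) (hdV'0 : ∀ k, dV' k ≠ 0)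

/-- **THE CHARACTER AT READING POINTS WITH `det α = 1`, `det β = d`** (the compact-picture points `kV (1, v)`, ref1 14:36:51Z): for reading points `pt x` of the SMALL arch
group with sign-frame components `archUFormPi_𝔻 (pt x) σ = kV (α_σ(x), β_σ(x))`, `det α_σ(x) = 1`, `det β_σ(x) = d_σ(x) ≠ 0`:
`archSWValue sB Y Φ_Gauss (pt x) = archSWValue sB Y Φ_Gauss 1 · ∏_σ d_σ(x)^{M₂·(t_{w(σ)}+1)∕2 − p′_σ}`, `p′_σ = #{k | 0 < σ(dV′_k)}` (★ PART 2b at `x := 1`, `k := pt x`, §1).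
[cite: KonnoKonno2007, Lemma 5.2 p. 73] [cite: LeeZhu1998, §5 (5.3)] [cite: Paul1998, §1.2 (1.2.1)–(1.2.2) p. 389] -/
theorem archSWValue_archFrameGauss_reading_of_det_snd {χ : HeckeCharacter L} (hχu : χ.IsUnitary) (hχs : IsSplittingChar L 1 χ)
    {sB : HA L e' dV hdV (tensorFrame L dW eW dV') (tensorFrame_real L dW hdW eW dV' hdV') →*
      MpD L e' dV hdV (tensorFrame L dW eW dV') (tensorFrame_real L dW hdW eW dV' hdV')}
    (hsB : IsDoubledWeilRep L e' dV hdV hdV0 (tensorFrame L dW eW dV') (tensorFrame_real L dW hdW eW dV' hdV')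
      (tensorFrame_ne_zero L dW eW dV' hdW0 hdV'0) χ sB)
    {t : InfinitePlace L → ℤ} (ht : χ.HasUnitaryArchType t 0) (hodd : ∀ w, Odd (t w))
    (Y : LocalSBFamily (Fp L) (Fin (n' + n'))) {X : Type*}
    (pt : X → UnitaryGroup.arch (Fp L) L (IsCMField.complexConj L) (n + n) (hermD L e dV hdV dW hdW))
    (α : ∀ (σ : {v : InfinitePlace (Fp L) // v.IsReal}) (_ : X), Matrix.unitaryGroup (PosIdx (signVec (cmPlaceOver L)
      (fun k => Sum.elim (cmGramEntry L e dV hdV dW hdW) (-cmGramEntry L e dV hdV dW hdW) ((e₂ n).symm k)) (imagUnit L) σ)) ℂ)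
    (β : ∀ (σ : {v : InfinitePlace (Fp L) // v.IsReal}) (_ : X), Matrix.unitaryGroup (NegIdx (signVec (cmPlaceOver L)
      (fun k => Sum.elim (cmGramEntry L e dV hdV dW hdW) (-cmGramEntry L e dV hdV dW hdW) ((e₂ n).symm k)) (imagUnit L) σ)) ℂ)
    (hfr : ∀ x σ, archUFormPi L (IsCMField.complexConj L) (n + n) (IsCMField.complexConj_ne_one L) (cmPlaceOver L) (cmPlaceOver_smul L)
        (cmPlaceOver_comap L) _ (gramD_gram_realDiagonal_entry_ne_zero L e dV hdV dW hdW hdV0 hdW0) (gramD_eq_diagonal_cm L e dV hdV dW hdW)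
        (J := hermD L e dV hdV dW hdW) rfl (complexConj_imagUnit L) (imagUnit_ne_zero L) (pt x) σ = UForm.kV _ _ (α σ x, β σ x))
    (d : X → {v : InfinitePlace (Fp L) // v.IsReal} → ℂ) (hd : ∀ x σ, d x σ ≠ 0)
    (hα : ∀ x σ, (α σ x).1.det = 1) (hβ : ∀ x σ, (β σ x).1.det = d x σ) (x : X) :
    archSWValue L e dV hdV hdV0 dW hdW hdW0 eW e' dV' hdV' hdV'0 sB Y
        (archFrameGauss L e' dV hdV hdV0 (tensorFrame L dW eW dV') (tensorFrame_real L dW hdW eW dV' hdV') (tensorFrame_ne_zero L dW eW dV' hdW0 hdV'0)) (pt x) =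
      archSWValue L e dV hdV hdV0 dW hdW hdW0 eW e' dV' hdV' hdV'0 sB Y
          (archFrameGauss L e' dV hdV hdV0 (tensorFrame L dW eW dV') (tensorFrame_real L dW hdW eW dV' hdV') (tensorFrame_ne_zero L dW eW dV' hdW0 hdV'0)) 1 *
        ∏ σ : {v : InfinitePlace (Fp L) // v.IsReal},
          d x σ ^ ((M₂ : ℤ) * ((t (cmPlaceOver L σ).1 + 1) / 2) -
            (Fintype.card (PosIdx fun k : Fin M₂ => embedding_of_isReal σ.2
              (⟨dV' k, (IsCMField.complexConj_eq_self_iff (K := L) (dV' k)).1 (hdV' k)⟩ : Fp L)) : ℤ)) := by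
  have h := archSWValue_archFrameGauss_mul_right_of_kV_cm L e dV hdV hdV0 dW hdW hdW0 eW e' dV' hdV' hdV'0 hχu hχs hsB ht hodd Y 1 (pt x)
    (fun σ => α σ x) (fun σ => β σ x) (fun σ => hfr x σ)
  rw [one_mul] at h
  rw [h, mul_comm]
  congr 1
  simp only [hα, hβ, one_mul, one_pow]
  exact prod_pow_zpow_mul_inv_prod_pow (d x) (hd x) M₂ _ _

/-- **THE MIRROR CHARACTER WITH `det α = d`, `det β = 1`**: exponent `M₂·(t_{w(σ)}+1)∕2 − q′_σ`, `q′_σ = #{k | ¬ 0 < σ(dV′_k)}` (for frames putting the moving block on the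
positive side). [cite: KonnoKonno2007, Lemma 5.2 p. 73] [cite: LeeZhu1998, §5 (5.3)] [cite: Paul1998, §1.2 (1.2.1)–(1.2.2) p. 389] -/
theorem archSWValue_archFrameGauss_reading_of_det_fst {χ : HeckeCharacter L} (hχu : χ.IsUnitary) (hχs : IsSplittingChar L 1 χ)
    {sB : HA L e' dV hdV (tensorFrame L dW eW dV') (tensorFrame_real L dW hdW eW dV' hdV') →*
      MpD L e' dV hdV (tensorFrame L dW eW dV') (tensorFrame_real L dW hdW eW dV' hdV')}
    (hsB : IsDoubledWeilRep L e' dV hdV hdV0 (tensorFrame L dW eW dV') (tensorFrame_real L dW hdW eW dV' hdV')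
      (tensorFrame_ne_zero L dW eW dV' hdW0 hdV'0) χ sB)
    {t : InfinitePlace L → ℤ} (ht : χ.HasUnitaryArchType t 0) (hodd : ∀ w, Odd (t w))
    (Y : LocalSBFamily (Fp L) (Fin (n' + n'))) {X : Type*}
    (pt : X → UnitaryGroup.arch (Fp L) L (IsCMField.complexConj L) (n + n) (hermD L e dV hdV dW hdW))
    (α : ∀ (σ : {v : InfinitePlace (Fp L) // v.IsReal}) (_ : X), Matrix.unitaryGroup (PosIdx (signVec (cmPlaceOver L)
      (fun k => Sum.elim (cmGramEntry L e dV hdV dW hdW) (-cmGramEntry L e dV hdV dW hdW) ((e₂ n).symm k)) (imagUnit L) σ)) ℂ)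
    (β : ∀ (σ : {v : InfinitePlace (Fp L) // v.IsReal}) (_ : X), Matrix.unitaryGroup (NegIdx (signVec (cmPlaceOver L)
      (fun k => Sum.elim (cmGramEntry L e dV hdV dW hdW) (-cmGramEntry L e dV hdV dW hdW) ((e₂ n).symm k)) (imagUnit L) σ)) ℂ)
    (hfr : ∀ x σ, archUFormPi L (IsCMField.complexConj L) (n + n) (IsCMField.complexConj_ne_one L) (cmPlaceOver L) (cmPlaceOver_smul L)
        (cmPlaceOver_comap L) _ (gramD_gram_realDiagonal_entry_ne_zero L e dV hdV dW hdW hdV0 hdW0) (gramD_eq_diagonal_cm L e dV hdV dW hdW)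
        (J := hermD L e dV hdV dW hdW) rfl (complexConj_imagUnit L) (imagUnit_ne_zero L) (pt x) σ = UForm.kV _ _ (α σ x, β σ x))
    (d : X → {v : InfinitePlace (Fp L) // v.IsReal} → ℂ) (hd : ∀ x σ, d x σ ≠ 0)
    (hα : ∀ x σ, (α σ x).1.det = d x σ) (hβ : ∀ x σ, (β σ x).1.det = 1) (x : X) :
    archSWValue L e dV hdV hdV0 dW hdW hdW0 eW e' dV' hdV' hdV'0 sB Y
        (archFrameGauss L e' dV hdV hdV0 (tensorFrame L dW eW dV') (tensorFrame_real L dW hdW eW dV' hdV') (tensorFrame_ne_zero L dW eW dV' hdW0 hdV'0)) (pt x) =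
      archSWValue L e dV hdV hdV0 dW hdW hdW0 eW e' dV' hdV' hdV'0 sB Y
          (archFrameGauss L e' dV hdV hdV0 (tensorFrame L dW eW dV') (tensorFrame_real L dW hdW eW dV' hdV') (tensorFrame_ne_zero L dW eW dV' hdW0 hdV'0)) 1 *
        ∏ σ : {v : InfinitePlace (Fp L) // v.IsReal},
          d x σ ^ ((M₂ : ℤ) * ((t (cmPlaceOver L σ).1 + 1) / 2) -
            (Fintype.card (NegIdx fun k : Fin M₂ => embedding_of_isReal σ.2
              (⟨dV' k, (IsCMField.complexConj_eq_self_iff (K := L) (dV' k)).1 (hdV' k)⟩ : Fp L)) : ℤ)) := by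
  have h := archSWValue_archFrameGauss_mul_right_of_kV_cm L e dV hdV hdV0 dW hdW hdW0 eW e' dV' hdV' hdV'0 hχu hχs hsB ht hodd Y 1 (pt x)
    (fun σ => α σ x) (fun σ => β σ x) (fun σ => hfr x σ)
  rw [one_mul] at h
  rw [h, mul_comm]
  congr 1
  simp only [hα, hβ, mul_one, one_pow]
  exact prod_pow_zpow_mul_inv_prod_pow (d x) (hd x) M₂ _ _

end Reading

end Summit.HodgeConjecture.HodgeConjecture.Cruxes.HLiu418.K2LiuArchSWAnchorCharacter

end
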